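import Summits.SmoothPoincare4.SmoothPoincare4.Theorems.CongruenceShadowsAgkCor6SufficiencyStubSeamFlowField

/-!
# Stub `stub_seamFlow` of line `lp-by-sphere-system-surgery` for crux `AgkCor6Sufficiency`, part 4:
# the unit-speed flow box around a seam piece (master theorem)
(item stmt-SmoothPoincare4-10894; lead reshape r5, SF; registered helper stub `stub_seamFlowMasterToolkit`)

**Master theorem `seamFlow_master`.**  For a normalised presentation with tube structure and seam
forms (`SpinePresentation`, `TubeStructure`, `SeamForms`), a seam `m`, and a radius `a` with
`9 r₀ ≤ a ≤ 10 r₀` such that `σ_m = G (refIdx m) - 1 = -2 p q` on the box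
`{p > r₀/2, |q| < r₀/2}` of the tube `T(a + r₀)`: there are an open `Nf ⊇ H_m ∖ T(2 r₀)` inside
`N m`, `δ > 0` and a flow `φ` (of a global smooth vector field `ζ` with `dσ_m(ζ) = 1` near the seam
piece and `ζ =` the explicit tube field on the part of radius `≤ a + r₀/2`) with all the clauses
of `SeamFlow`, the explicit form `φ x t = tubeFlow m u v ρ tp x t` holding on `Nf ∩ T(a)`.
(With `a = 10 r₀` this is `SeamFlow` verbatim, given `σ_m`-control on `T(11 r₀)`; with `a = 9 r₀`
the control needed is the field `SeamForms.sigma_tube`.)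

Proof: Milnor's device (h-cobordism theorem, proof of Thm. 3.4): glue the explicit field (where it
has unit speed) with local unit-speed fields by a partition of unity (`exists_field_eq_and_unit`),
take the global flow (`Literature.Topology.FourManifolds.flow`: `X` is closed), the clock
(`flow_unit_speed`), flow boxes by compactness (`exists_time_of_compact`), and identify the flow
with the explicit one in the tube by uniqueness of integral curves
(`eqOn_flow_of_isMIntegralCurveOn`, `hasMFDerivAt_tubeFlow_tubeField`).

References: Milnor, *Lectures on the h-cobordism theorem* (1965), proof of Thm. 3.4
[MilnorHCobordism1965]; Abrams–Gay–Kirby, Geom. Topol. 22 (2018), proof of Thm. 5 [AbramsGayKirby2018].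
-/

noncomputable section

set_option linter.dupNamespace false

namespace Summit.SmoothPoincare4.SmoothPoincare4.Cruxes.AgkCor6Sufficiency.LpBySphereSystemSurgery

open Set Function Filter
open scoped _root_.Manifold _root_.ContDiff _root_.Topology
open Literature.Topology.FourManifolds

section Seam

variable {X : Type} [TopologicalSpace X] [ChartedSpace (EuclideanSpace ℝ (Fin 4)) X]
  {S : Fin 3 → Set X} {u v : X → ℝ} {ρ : X → X} {U O : Set X} {c : Fin 3 → ℕ → ℕ}

/-- **The seams in seam coordinates**: on `U`, a point of `H_m = S (m+1) ∩ S (m+2)` has `q_m = 0`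
and `p_m ≥ 0` (wedge algebra of the tri-normal form). -/
theorem seam_coords (hT : TriNormalForm S 0 1 2 u v ρ U O c) (m : Fin 3) {x : X} (hxU : x ∈ U)
    (hx : x ∈ S (m + 1) ∩ S (m + 2)) : qCo m (u x) (v x) = 0 ∧ 0 ≤ pCo m (u x) (v x) := by
  have h0 := hT.mem_i x hxU
  have h1 := hT.mem_j x hxU
  have h2 := hT.mem_l x hxU
  fin_cases m
  · have hx1 : x ∈ S 1 := by simpa using hx.1
    have hx2 : x ∈ S 2 := by simpa using hx.2
    obtain ⟨hu, huv⟩ := h1.1 hx1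
    obtain ⟨hv, hvu⟩ := h2.1 hx2
    simp only [qCo, pCo]
    norm_num
    constructor <;> linarith
  · have hx1 : x ∈ S 2 := by simpa using hx.1
    have hx2 : x ∈ S 0 := by simpa using hx.2
    obtain ⟨hv, hvu⟩ := h2.1 hx1
    obtain ⟨hu, hv'⟩ := h0.1 hx2
    simp only [qCo, pCo]
    norm_num
    constructor <;> linarith
  · have hx1 : x ∈ S 0 := by simpa using hx.1
    have hx2 : x ∈ S 1 := by simpa using hx.2
    obtain ⟨hu, hv⟩ := h0.1 hx1
    obtain ⟨hu', huv⟩ := h1.1 hx2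
    simp only [qCo, pCo]
    norm_num
    constructor <;> linarith

/-- On the seam ray, `u² + v² ≤ 2 p²`. -/
theorem sq_le_of_seam (m : Fin 3) {a b : ℝ} (hq : qCo m a b = 0) :
    a ^ 2 + b ^ 2 ≤ 2 * pCo m a b ^ 2 := by
  have hu := uOfPQ_pCo_qCo m a b
  have hv := vOfPQ_pCo_qCo m a b
  rw [hq] at hu hv
  have := sq_ray_le m (pCo m a b)
  rw [hu, hv] at this
  exact this

end Seam

/-! ## The master theorem -/

section Master

variable {X : Type} [TopologicalSpace X] [T2Space X]
  [ChartedSpace (EuclideanSpace ℝ (Fin 4)) X] [IsManifold (𝓡 4) ∞ X] [CompactSpace X]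

/-- `|s / (2 P)| ≤ r₀ / 4` for `|s| < δ ≤ r₀² / 2` and `P > r₀ > 0`. -/
theorem abs_time_div_le {r₀ P s δ : ℝ} (hr₀ : 0 < r₀) (hP : r₀ < P) (hs : |s| < δ) (hδ : δ ≤ r₀ ^ 2 / 2) :
    |s / (2 * P)| ≤ r₀ / 4 := by
  have hP0 : 0 < 2 * P := by linarith
  rw [abs_div, abs_of_pos hP0, div_le_iff₀ hP0]
  nlinarith [abs_nonneg s]

/-- **Master theorem of the seam flow** (see the module docstring). -/
theorem seamFlow_master (S : Fin 3 → Set X) (u v : X → ℝ) (ρ : X → X) (U O T₀ : Set X) (k : ℕ)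
    (Ot : Set X) (rt : ℝ) (tp : X → ℝ → ℝ → X) (G : Fin 3 → X → ℝ) (r₀ ε₁ : ℝ)
    (N : Fin 3 → Set X) (hP : SpinePresentation S u v ρ U O T₀ G k)
    (hTS : TubeStructure (S 0) (⋂ l, S l) u v ρ O Ot rt tp) (hrt : 20 * r₀ ≤ rt)
    (hSF : SeamForms S u v Ot G r₀ ε₁ N) (m : Fin 3) (a : ℝ) (ha : 9 * r₀ ≤ a) (ha' : a ≤ 10 * r₀)
    (hσ : ∀ x ∈ tubeSet Ot u v (a + r₀), r₀ / 2 < pCo m (u x) (v x) → |qCo m (u x) (v x)| < r₀ / 2 →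
      G (refIdx m) x - 1 = -2 * pCo m (u x) (v x) * qCo m (u x) (v x)) :
    ∃ (Nf : Set X) (δ : ℝ) (φ : X → ℝ → X),
      0 < δ ∧ IsOpen Nf ∧ Nf ⊆ N m ∧
      (∀ x ∈ S (m + 1) ∩ S (m + 2), x ∉ tubeSet Ot u v (2 * r₀) → x ∈ Nf) ∧
      (∀ x ∈ S (m + 1) ∩ S (m + 2), x ∉ tubeSet Ot u v (2 * r₀) → ∀ t ∈ Ioo (-δ) δ, φ x t ∈ Nf) ∧
      ContMDiffOn ((𝓡 4).prod 𝓘(ℝ, ℝ)) (𝓡 4) ∞ (uncurry φ) (Nf ×ˢ Ioo (-δ) δ) ∧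
      (∀ x ∈ Nf, ∀ t ∈ Ioo (-δ) δ, φ x t ∈ N m) ∧
      (∀ x ∈ Nf, φ x 0 = x) ∧
      (∀ x ∈ Nf, ∀ s t : ℝ, s ∈ Ioo (-δ) δ → t ∈ Ioo (-δ) δ → s + t ∈ Ioo (-δ) δ →
        φ x s ∈ Nf → φ (φ x s) t = φ x (s + t)) ∧
      (∀ x ∈ Nf, ∀ t ∈ Ioo (-δ) δ, G (refIdx m) (φ x t) - 1 = (G (refIdx m) x - 1) + t) ∧
      (∀ x ∈ Nf, x ∈ tubeSet Ot u v a → ∀ t ∈ Ioo (-δ) δ, φ x t = tubeFlow m u v ρ tp x t) ∧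
      (∀ x ∈ Nf, ∀ t ∈ Ioo (-δ) δ,
        (x ∈ tubeSet Ot u v (9 * r₀) → φ x t ∈ tubeSet Ot u v (10 * r₀)) ∧
        (x ∉ tubeSet Ot u v (9 * r₀) → φ x t ∉ tubeSet Ot u v (8 * r₀))) := by
  haveI : LocallyCompactSpace X := ChartedSpace.locallyCompactSpace (EuclideanSpace ℝ (Fin 4)) X
  -- ### data
  have hfr : NormalFrame (⋂ l, S l) u v ρ U O := hP.tri.frame
  have hr₀ : 0 < r₀ := hSF.r₀_pos
  set Gm : X → ℝ := G (refIdx m) with hGm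
  have hGs : ContMDiff (𝓡 4) 𝓘(ℝ, ℝ) ∞ Gm := hP.contMDiff_G _
  set P : X → ℝ := fun x => pCo m (u x) (v x) with hPdef
  set Q : X → ℝ := fun x => qCo m (u x) (v x) with hQdef
  have hPc : Continuous P :=
    (contDiff_pCo m).continuous.comp (hfr.contMDiff_u.continuous.prodMk hfr.contMDiff_v.continuous)
  have hQc : Continuous Q :=
    (contDiff_qCo m).continuous.comp (hfr.contMDiff_u.continuous.prodMk hfr.contMDiff_v.continuous)
  have huvc : Continuous fun x => u x ^ 2 + v x ^ 2 :=
    (hfr.contMDiff_u.continuous.pow 2).add (hfr.contMDiff_v.continuous.pow 2)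
  have hTo : ∀ s : ℝ, IsOpen (tubeSet Ot u v s) := isOpen_tubeSet hTS hfr
  -- ### the seam piece
  set H : Set X := S (m + 1) ∩ S (m + 2) with hH
  have hHc : IsClosed H := (hP.tri.isCompact _).isClosed.inter (hP.tri.isCompact _).isClosed
  set K₀ : Set X := H ∩ (tubeSet Ot u v (2 * r₀))ᶜ with hK₀
  have hK₀c : IsCompact K₀ := (hHc.inter (hTo _).isClosed_compl).isCompact
  have hK₀N : K₀ ⊆ N m := fun x hx => hSF.seam_subset_N m x hx.1 hx.2
  -- seam points of the tube: `Q = 0`, `P > r₀`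
  have hK₀PQ : ∀ x ∈ K₀, x ∈ Ot → r₀ < P x ∧ Q x = 0 := by
    rintro x ⟨hxH, hxT⟩ hxOt
    have hxU : x ∈ U := hfr.O_subset_U (hTS.subset_O hxOt)
    obtain ⟨hq, hp⟩ := seam_coords hP.tri m hxU hxH
    have hge : 4 * r₀ ^ 2 ≤ u x ^ 2 + v x ^ 2 := by
      by_contra hlt
      exact hxT ⟨hxOt, by nlinarith⟩
    have hle := sq_le_of_seam m hq
    refine ⟨?_, hq⟩
    show r₀ < pCo m (u x) (v x)
    nlinarith
  -- ### regions
  set M₁ : Set X := {x | x ∈ Ot ∧ u x ^ 2 + v x ^ 2 ≤ (a + r₀ / 2) ^ 2} with hM₁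
  set Ma : Set X := {x | x ∈ Ot ∧ u x ^ 2 + v x ^ 2 ≤ a ^ 2} with hMa
  have hM₁c : IsClosed M₁ := isClosed_closedTube hTS hfr (by linarith) (by linarith)
  have hMac : IsClosed Ma := isClosed_closedTube hTS hfr (by linarith) (by linarith)
  have hMaM₁ : Ma ⊆ M₁ := fun x hx => ⟨hx.1, hx.2.trans (by nlinarith)⟩
  set Box : Set X := {x | x ∈ tubeSet Ot u v (a + r₀) ∧ r₀ / 2 < P x ∧ |Q x| < r₀ / 2} with hBox
  set Box₀ : Set X := {x | x ∈ tubeSet Ot u v (a + r₀) ∧ r₀ < P x ∧ |Q x| < r₀ / 4} with hBox₀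
  have hBoxo : IsOpen Box :=
    (hTo _).and ((isOpen_lt continuous_const hPc).and (isOpen_lt (continuous_abs.comp hQc) continuous_const))
  have hBox₀o : IsOpen Box₀ :=
    (hTo _).and ((isOpen_lt continuous_const hPc).and (isOpen_lt (continuous_abs.comp hQc) continuous_const))
  have hBox₀Box : Box₀ ⊆ Box := fun x hx => ⟨hx.1, by linarith [hx.2.1], by linarith [hx.2.2]⟩
  have hBoxOt : Box ⊆ Ot := fun x hx => hx.1.1
  set Ω : Set X := N m ∩ (Box₀ ∪ M₁ᶜ) with hΩ
  have hΩo : IsOpen Ω := (hSF.isOpen_N m).inter (hBox₀o.union hM₁c.isOpen_compl)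
  have hK₀Ω : K₀ ⊆ Ω := by
    intro x hx
    refine ⟨hK₀N hx, ?_⟩
    by_cases hxM : x ∈ M₁
    · left
      obtain ⟨hp, hq⟩ := hK₀PQ x hx hxM.1
      refine ⟨⟨hxM.1, lt_of_le_of_lt hxM.2 (by nlinarith)⟩, hp, ?_⟩
      show |Q x| < r₀ / 4
      rw [hq, abs_zero]; positivity
    · right; exact hxM
  obtain ⟨K, hKc, hK₀K, hKΩ⟩ := exists_compact_between hK₀c hΩo hK₀Ω
  have hKN : K ⊆ N m := fun x hx => (hKΩ hx).1
  have hKM₁ : K ∩ M₁ ⊆ Box₀ := by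
    rintro x ⟨hxK, hxM⟩
    rcases (hKΩ hxK).2 with h | h
    · exact h
    · exact absurd hxM h
  -- ### the vector field
  obtain ⟨C, W, hCW⟩ := exists_chartChoice hTS
  have hζ₀s : ContMDiffOn (𝓡 4) (𝓡 4).tangent ∞
      (fun x => (⟨x, tubeField m ρ C x⟩ : TangentBundle (𝓡 4) X)) Box :=
    (contMDiffOn_tubeField (m := m) hTS hfr hCW).mono fun x hx => ⟨hx.1.1, by
      show pCo m (u x) (v x) ≠ 0
      have : r₀ / 2 < pCo m (u x) (v x) := hx.2.1
      linarith⟩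
  have hunit : ∀ y ∈ Box, y ∈ K → mlineDeriv (𝓡 4) Gm y (tubeField m ρ C y) = 1 := by
    intro y hy _
    refine mlineDeriv_tubeField_eq_one hTS hfr hCW hGs hBoxo hBoxOt (fun z hz => ?_) hy ?_
    · exact hσ z hz.1 hz.2.1 hz.2.2
    · have : r₀ / 2 < pCo m (u y) (v y) := hy.2.1
      show pCo m (u y) (v y) ≠ 0
      linarith
  have hreg : ∀ y ∈ K, mfderiv (𝓡 4) 𝓘(ℝ, ℝ) Gm y ≠ 0 := fun y hy => hSF.regular_N m y (hKN hy)
  obtain ⟨ζ, hζA, hζK⟩ := exists_field_eq_and_unit hGs (hKc.isClosed.inter hM₁c) hKc.isClosed hBoxo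
    (fun x hx => hBox₀Box (hKM₁ hx)) hζ₀s hunit hreg
  have hζs : ContMDiff (𝓡 4) (𝓡 4).tangent ∞ fun x => (⟨x, ζ x⟩ : TangentBundle (𝓡 4) X) :=
    ζ.contMDiff
  -- ### the flow and the layers
  set φ : X → ℝ → X := flow hζs with hφ
  have hφc : Continuous fun z : X × ℝ => φ z.1 z.2 :=
    (contMDiff_flow hζs).continuous.comp (continuous_snd.prodMk continuous_fst)
  obtain ⟨K₁, hK₁c, hK₀K₁, hK₁K⟩ := exists_compact_between hK₀c isOpen_interior hK₀K
  obtain ⟨Nf, hNfo, hK₀Nf, hNfK₁, hNfc⟩ := exists_open_between_and_isCompact_closure hK₀c isOpen_interior hK₀K₁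
  have hK₁K' : K₁ ⊆ K := hK₁K.trans interior_subset
  have hNfK₁' : Nf ⊆ K₁ := (subset_closure.trans hNfK₁).trans interior_subset
  -- ### the four times
  obtain ⟨δ₁, hδ₁, h1⟩ := exists_time_of_compact (g := fun z : X × ℝ => φ z.1 z.2) isOpen_univ
    hφc.continuousOn hK₁c isOpen_interior (fun _ _ => mem_univ _)
    (fun x hx => by show φ x 0 ∈ interior K; rw [hφ, flow_zero]; exact hK₁K hx)
  obtain ⟨δ₂, hδ₂, h2⟩ := exists_time_of_compact (g := fun z : X × ℝ => φ z.1 z.2) isOpen_univ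
    hφc.continuousOn hNfc isOpen_interior (fun _ _ => mem_univ _)
    (fun x hx => by show φ x 0 ∈ interior K₁; rw [hφ, flow_zero]; exact hNfK₁ hx)
  obtain ⟨δ₃, hδ₃, h3⟩ := exists_time_of_compact (g := fun z : X × ℝ => φ z.1 z.2) isOpen_univ
    hφc.continuousOn hK₀c hNfo (fun _ _ => mem_univ _)
    (fun x hx => by show φ x 0 ∈ Nf; rw [hφ, flow_zero]; exact hK₀Nf hx)
  -- the explicit flow near `(K₁ ∩ Ma) × {0}`
  set D' : Set (X × ℝ) := {z | z.1 ∈ tubeSet Ot u v (12 * r₀) ∧ r₀ / 2 < P z.1 ∧ |z.2| < r₀ ^ 2} with hD'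
  have hD'o : IsOpen D' :=
    ((hTo _).preimage continuous_fst).and ((isOpen_lt continuous_const (hPc.comp continuous_fst)).and
      (isOpen_lt (continuous_abs.comp continuous_snd) continuous_const))
  have hD'c : ContinuousOn (uncurry (tubeFlow m u v ρ tp)) D' := by
    refine (contMDiffOn_tubeFlow hTS hfr).continuousOn.mono ?_
    rintro z ⟨hxT, hxP, hs⟩
    have hxP' : r₀ / 2 < pCo m (u z.1) (v z.1) := hxP
    have hP0 : 0 < 2 * pCo m (u z.1) (v z.1) := by linarith
    refine ⟨hxT.1, hP0.ne' ∘ fun h => by rw [h, mul_zero], ?_⟩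
    have hsd : |z.2 / (2 * pCo m (u z.1) (v z.1))| ≤ r₀ := by
      have hs' : |z.2| < r₀ ^ 2 := hs
      rw [abs_div, abs_of_pos hP0, div_le_iff₀ hP0]
      nlinarith [abs_nonneg z.2]
    have := sq_tubeFlow_lt m u v z.1 z.2 (R := 12 * r₀) (by linarith) hxT.2 hsd
    show _ < rt ^ 2
    nlinarith
  obtain ⟨δ₄, hδ₄, h4⟩ := exists_time_of_compact hD'o hD'c (hK₁c.inter_right hMac) isOpen_interior
    (fun x hx => by
      obtain ⟨hxT, hp, -⟩ := hKM₁ ⟨hK₁K' hx.1, hMaM₁ hx.2⟩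
      refine ⟨⟨hxT.1, lt_of_le_of_lt hx.2.2 (by nlinarith)⟩, by show r₀ / 2 < pCo m (u x) (v x); linarith, ?_⟩
      show |(0 : ℝ)| < r₀ ^ 2
      rw [abs_zero]; positivity)
    (fun x hx => by
      show tubeFlow m u v ρ tp x 0 ∈ interior K
      rw [tubeFlow_zero hTS hx.2.1]; exact hK₁K hx.1)
  -- ### δ
  set δ : ℝ := min (min (min δ₁ δ₂) (min δ₃ δ₄)) (r₀ ^ 2 / 2) with hδ
  have hδpos : 0 < δ := by simp only [hδ, lt_min_iff]; exact ⟨⟨⟨hδ₁, hδ₂⟩, hδ₃, hδ₄⟩, by positivity⟩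
  have hδ₁' : δ ≤ δ₁ := (min_le_left _ _).trans ((min_le_left _ _).trans (min_le_left _ _))
  have hδ₂' : δ ≤ δ₂ := (min_le_left _ _).trans ((min_le_left _ _).trans (min_le_right _ _))
  have hδ₃' : δ ≤ δ₃ := (min_le_left _ _).trans ((min_le_right _ _).trans (min_le_left _ _))
  have hδ₄' : δ ≤ δ₄ := (min_le_left _ _).trans ((min_le_right _ _).trans (min_le_right _ _))
  have hδr : δ ≤ r₀ ^ 2 / 2 := min_le_right _ _
  have habs : ∀ {t : ℝ}, t ∈ Ioo (-δ) δ → |t| < δ := fun ht => abs_lt.2 ⟨ht.1, ht.2⟩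
  -- ### the explicit form on `K₁ ∩ Ma`
  have hexpl : ∀ x ∈ K₁ ∩ Ma, x ∈ Ot ∧ r₀ < P x ∧ ∀ t ∈ Ioo (-δ) δ,
      |t / (2 * pCo m (u x) (v x))| ≤ r₀ / 4 ∧ φ x t = tubeFlow m u v ρ tp x t := by
    rintro x ⟨hxK₁, hxMa⟩
    obtain ⟨hxT, hp, -⟩ := hKM₁ ⟨hK₁K' hxK₁, hMaM₁ hxMa⟩
    have hxOt : x ∈ Ot := hxT.1
    have hp' : r₀ < pCo m (u x) (v x) := hp
    have hsd : ∀ s ∈ Ioo (-δ) δ, |s / (2 * pCo m (u x) (v x))| ≤ r₀ / 4 := fun s hs =>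
      abs_time_div_le hr₀ hp' (habs hs) hδr
    -- disc condition and membership in `K ∩ M₁` along the explicit flow
    have hdisc : ∀ s ∈ Ioo (-δ) δ,
        uOfPQ m (pCo m (u x) (v x)) (qCo m (u x) (v x) - s / (2 * pCo m (u x) (v x))) ^ 2 +
        vOfPQ m (pCo m (u x) (v x)) (qCo m (u x) (v x) - s / (2 * pCo m (u x) (v x))) ^ 2 <
          (a + r₀ / 2) ^ 2 := fun s hs => by
      have := sq_tubeFlow_lt m u v x s (R := a + r₀ / 4) (d := r₀ / 4) (by linarith)
        (lt_of_le_of_lt hxMa.2 (by nlinarith)) (hsd s hs)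
      nlinarith
    have hdisc' : ∀ s ∈ Ioo (-δ) δ,
        uOfPQ m (pCo m (u x) (v x)) (qCo m (u x) (v x) - s / (2 * pCo m (u x) (v x))) ^ 2 +
        vOfPQ m (pCo m (u x) (v x)) (qCo m (u x) (v x) - s / (2 * pCo m (u x) (v x))) ^ 2 < rt ^ 2 :=
      fun s hs => (hdisc s hs).trans_le (by nlinarith)
    have hmemA : ∀ s ∈ Ioo (-δ) δ, tubeFlow m u v ρ tp x s ∈ K ∩ M₁ := by
      intro s hs
      obtain ⟨hy, -, hu, hv, -⟩ := tubeFlow_spec hTS hfr hxOt (hdisc' s hs)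
      refine ⟨interior_subset (h4 x ⟨hxK₁, hxMa⟩ s ((habs hs).le.trans hδ₄')).2, hy, ?_⟩
      rw [hu, hv]; exact (hdisc s hs).le
    -- integral curve of `ζ`
    have hint : IsMIntegralCurveOn (tubeFlow m u v ρ tp x) (fun y => ζ y) (Ioo (-δ) δ) := by
      intro s hs
      have h := hasMFDerivAt_tubeFlow_tubeField (m := m) hTS hfr hCW hxOt (hdisc' s hs)
      rw [← hζA _ (hmemA s hs)] at h
      exact h.hasMFDerivWithinAt
    have h0 : (0 : ℝ) ∈ Ioo (-δ) δ := ⟨by linarith, hδpos⟩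
    have heq := eqOn_flow_of_isMIntegralCurveOn hζs h0 hint
    rw [tubeFlow_zero hTS hxOt] at heq
    exact ⟨hxOt, hp', fun t ht => ⟨hsd t ht, (heq ht).symm⟩⟩
  -- ### the clauses
  refine ⟨Nf, δ, φ, hδpos, hNfo, hNfK₁'.trans (hK₁K'.trans hKN), fun x hx hxT => hK₀Nf ⟨hx, hxT⟩,
    fun x hx hxT t ht => (h3 x ⟨hx, hxT⟩ t ((habs ht).le.trans hδ₃')).2, ?_,
    fun x hx t ht => hKN (hK₁K' (interior_subset (h2 x (subset_closure hx) t ((habs ht).le.trans hδ₂')).2)),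
    fun x _ => flow_zero hζs x, fun x _ s t _ _ _ _ => (flow_add hζs x s t).symm, ?_, ?_, ?_⟩
  · -- smoothness
    have := (contMDiff_flow hζs).comp (contMDiff_snd.prodMk contMDiff_fst :
      ContMDiff ((𝓡 4).prod 𝓘(ℝ, ℝ)) (𝓘(ℝ, ℝ).prod (𝓡 4)) ∞ fun z : X × ℝ => (z.2, z.1))
    exact this.contMDiffOn
  · -- unit speed
    intro x hx t ht
    have key : ∀ s ∈ Icc (-|t|) (|t|), mlineDeriv (𝓡 4) Gm (flow hζs x s) (ζ (flow hζs x s)) = 1 := by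
      intro s hs
      apply hζK
      have hs' : |s| ≤ δ₂ := (abs_le.2 ⟨hs.1, hs.2⟩).trans ((habs ht).le.trans hδ₂')
      exact hK₁K' (interior_subset (h2 x (subset_closure hx) s hs').2)
    have hts : Gm (φ x t) = Gm x + t := flow_unit_speed hζs hGs key (t := t) ⟨neg_abs_le t, le_abs_self t⟩
    rw [hts]; ring
  · -- explicit form on `Nf ∩ T(a)`
    intro x hx hxT t ht
    exact ((hexpl x ⟨hNfK₁' hx, hxT.1, hxT.2.le⟩).2.2 t ht).2
  · -- tube stability
    intro x hx t ht
    constructor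
    · intro hx9
      have hxa : x ∈ Ma := ⟨hx9.1, hx9.2.le.trans (by nlinarith)⟩
      obtain ⟨hxOt, -, hst⟩ := hexpl x ⟨hNfK₁' hx, hxa⟩
      obtain ⟨hsd, he⟩ := hst t ht
      have hlt := sq_tubeFlow_lt m u v x t (R := 9 * r₀) (d := r₀ / 4) (by linarith) hx9.2 hsd
      have hlt' : uOfPQ m (pCo m (u x) (v x)) (qCo m (u x) (v x) - t / (2 * pCo m (u x) (v x))) ^ 2 +
          vOfPQ m (pCo m (u x) (v x)) (qCo m (u x) (v x) - t / (2 * pCo m (u x) (v x))) ^ 2 < rt ^ 2 :=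
        hlt.trans_le (by nlinarith)
      obtain ⟨hy, -, hu, hv, -⟩ := tubeFlow_spec hTS hfr hxOt hlt'
      rw [he]
      exact ⟨hy, by rw [hu, hv]; exact hlt.trans_le (by nlinarith)⟩
    · intro hx9 hy8
      -- flow back from `y = φ x t ∈ T(8 r₀)` explicitly
      set y := φ x t with hy
      have hyK₁ : y ∈ K₁ := interior_subset (h2 x (subset_closure hx) t ((habs ht).le.trans hδ₂')).2
      have hya : y ∈ Ma := ⟨hy8.1, hy8.2.le.trans (by nlinarith)⟩
      obtain ⟨hyOt, -, hst⟩ := hexpl y ⟨hyK₁, hya⟩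
      have hnt : -t ∈ Ioo (-δ) δ := ⟨by linarith [ht.2], by linarith [ht.1]⟩
      obtain ⟨hsd, he⟩ := hst (-t) hnt
      have hback : φ y (-t) = x := by rw [hy, hφ]; exact flow_neg_flow hζs x t
      have hlt := sq_tubeFlow_lt m u v y (-t) (R := 8 * r₀) (d := r₀ / 4) (by linarith) hy8.2 hsd
      have hlt' : uOfPQ m (pCo m (u y) (v y)) (qCo m (u y) (v y) - -t / (2 * pCo m (u y) (v y))) ^ 2 +
          vOfPQ m (pCo m (u y) (v y)) (qCo m (u y) (v y) - -t / (2 * pCo m (u y) (v y))) ^ 2 < rt ^ 2 :=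
        hlt.trans_le (by nlinarith)
      obtain ⟨hz, -, hu, hv, -⟩ := tubeFlow_spec hTS hfr hyOt hlt'
      apply hx9
      rw [← hback, he]
      exact ⟨hz, by rw [hu, hv]; exact hlt.trans_le (by nlinarith)⟩

end Master

/-! ## The registered helper stub -/

/-- **The master toolkit** (registered helper stub `stub_seamFlowMasterToolkit` of `stub_seamFlow`):
the statement of `seamFlow_master`. -/
def SeamFlowMasterToolkit : Prop :=
  ∀ (X : Type) [TopologicalSpace X] [T2Space X] [ChartedSpace (EuclideanSpace ℝ (Fin 4)) X]
    [IsManifold (𝓡 4) ∞ X] [CompactSpace X]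
    (S : Fin 3 → Set X) (u v : X → ℝ) (ρ : X → X) (U O T₀ : Set X) (k : ℕ)
    (Ot : Set X) (rt : ℝ) (tp : X → ℝ → ℝ → X) (G : Fin 3 → X → ℝ) (r₀ ε₁ : ℝ)
    (N : Fin 3 → Set X), SpinePresentation S u v ρ U O T₀ G k →
    TubeStructure (S 0) (⋂ l, S l) u v ρ O Ot rt tp → 20 * r₀ ≤ rt → SeamForms S u v Ot G r₀ ε₁ N →
    ∀ (m : Fin 3) (a : ℝ), 9 * r₀ ≤ a → a ≤ 10 * r₀ →
    (∀ x ∈ tubeSet Ot u v (a + r₀), r₀ / 2 < pCo m (u x) (v x) → |qCo m (u x) (v x)| < r₀ / 2 →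
      G (refIdx m) x - 1 = -2 * pCo m (u x) (v x) * qCo m (u x) (v x)) →
    ∃ (Nf : Set X) (δ : ℝ) (φ : X → ℝ → X),
      0 < δ ∧ IsOpen Nf ∧ Nf ⊆ N m ∧
      (∀ x ∈ S (m + 1) ∩ S (m + 2), x ∉ tubeSet Ot u v (2 * r₀) → x ∈ Nf) ∧
      (∀ x ∈ S (m + 1) ∩ S (m + 2), x ∉ tubeSet Ot u v (2 * r₀) → ∀ t ∈ Ioo (-δ) δ, φ x t ∈ Nf) ∧
      ContMDiffOn ((𝓡 4).prod 𝓘(ℝ, ℝ)) (𝓡 4) ∞ (uncurry φ) (Nf ×ˢ Ioo (-δ) δ) ∧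
      (∀ x ∈ Nf, ∀ t ∈ Ioo (-δ) δ, φ x t ∈ N m) ∧
      (∀ x ∈ Nf, φ x 0 = x) ∧
      (∀ x ∈ Nf, ∀ s t : ℝ, s ∈ Ioo (-δ) δ → t ∈ Ioo (-δ) δ → s + t ∈ Ioo (-δ) δ →
        φ x s ∈ Nf → φ (φ x s) t = φ x (s + t)) ∧
      (∀ x ∈ Nf, ∀ t ∈ Ioo (-δ) δ, G (refIdx m) (φ x t) - 1 = (G (refIdx m) x - 1) + t) ∧
      (∀ x ∈ Nf, x ∈ tubeSet Ot u v a → ∀ t ∈ Ioo (-δ) δ, φ x t = tubeFlow m u v ρ tp x t) ∧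
      (∀ x ∈ Nf, ∀ t ∈ Ioo (-δ) δ,
        (x ∈ tubeSet Ot u v (9 * r₀) → φ x t ∈ tubeSet Ot u v (10 * r₀)) ∧
        (x ∉ tubeSet Ot u v (9 * r₀) → φ x t ∉ tubeSet Ot u v (8 * r₀)))

/-- **Registered helper stub `stub_seamFlowMasterToolkit`.** -/
theorem stub_seamFlowMasterToolkit : SeamFlowMasterToolkit :=
  fun _ _ _ _ _ _ S u v ρ U O T₀ k Ot rt tp G r₀ ε₁ N hP hTS hrt hSF m a ha ha' hσ =>
    seamFlow_master S u v ρ U O T₀ k Ot rt tp G r₀ ε₁ N hP hTS hrt hSF m a ha ha' hσ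

end Summit.SmoothPoincare4.SmoothPoincare4.Cruxes.AgkCor6Sufficiency.LpBySphereSystemSurgery

end
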